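import Mathlib
import Summits.MatrixMultiplication.MatrixMultiplication.Theses.SnSubsetDichotomy
import Literature.Barriers.MatrixMultiplication.NilpotentGroupBarrier
import Literature.Barriers.MatrixMultiplication.NilpotentGroupBarrierGradedCoords

/-!
Crux-ideate sketches for `NoThresholdSubsetTriple` (stmt-MatrixMultiplication-8302), round 1,
ideator 1. First lemmas of the two idea cards; statements only need to elaborate.
-/

namespace Summit.MatrixMultiplication.MatrixMultiplication.Cruxes.NoThresholdSubsetTriple.Sketch

open Literature.Barriers.MatrixMultiplication Literature.Combinatorics.Additive
open Literature.Computability.AlgebraicComplexity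
open Summit.MatrixMultiplication.MatrixMultiplication.Theses.SnSubsetDichotomy

/-! ## Card 1 — two-modular Loewy slice rank -/

/-- Transfer statement C⁺ (BCCGU17 §5, corrected exponent): the slice rank of the group tensor
`D_{S_n}(x,y,z) = [xyz = 1]` over an algebraically closed field of characteristic `2` is at most
`n! · e^{-K√n}` for some `K > 0` and all large `n`. -/
def TwoModularSliceRank : Prop :=
  ∃ K : ℝ, 0 < K ∧ ∃ n₀ : ℕ, ∀ n ≥ n₀,
    (sliceRank (mulGroupTensor (AlgebraicClosure (ZMod 2)) (Equiv.Perm (Fin n))) : ℝ) ≤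
      (n.factorial : ℝ) * Real.exp (-(K * Real.sqrt (n : ℝ)))

/-- FIRST LEMMA (card 1; provable now from tree lemmas `RealizesTPP.tensorRestrictsTo`,
`sliceRank_le_of_tensorRestrictsTo`, `sliceRank_groupTensor`, `BCCGU2017_propB6.of_field`):
a TPP triple with three sets of size `N` forces `N² ≤ slice-rank_K(D_{S_n})` over EVERY field `K`,
in particular in characteristic `2`. -/
def FirstLemmaSliceRankLower : Prop :=
  BCCGU2017_propB6 →
    ∀ (K : Type) [Field K] (n N : ℕ) (S T U : Finset (Equiv.Perm (Fin n))),
      TripleProductProperty S T U → S.card = N → T.card = N → U.card = N →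
        N ^ 2 ≤ sliceRank (mulGroupTensor K (Equiv.Perm (Fin n)))

/-- The transfer: C⁺ (with Prop. B.6) implies the crux. Proof sketch: a threshold triple has all
three sets of size ≥ √(n!)e^{-c√n} (pairwise packing), shrink to a balanced sub-triple (TPP is
hereditary), apply the first lemma, compare with C⁺ for `c < K/2`. -/
theorem transfer_card1 (hB6 : BCCGU2017_propB6) (hC : TwoModularSliceRank)
    (hL : FirstLemmaSliceRankLower) : NoThresholdSubsetTriple := by
  sorry

/-- MECHANISM STATEMENT (card 1): graded coordinates on `K[S_n]`, `char K = 2`, with a THIN SPLIT —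
the codimension bound of BCCGU Prop. 3.2 (tree: `GradedCoords.sliceRank_le`) is at most
`n!·e^{-K√n}`. Intended witness: a basis adapted to the radical (Loewy) filtration of `K[S_n]`. -/
def LoewyThinSplit : Prop :=
  ∃ K : ℝ, 0 < K ∧ ∃ n₀ : ℕ, ∀ n ≥ n₀, ∃ (Λ : Type) (_ : Fintype Λ) (_ : DecidableEq Λ)
    (B : GradedCoords (AlgebraicClosure (ZMod 2)) (Equiv.Perm (Fin n)) Λ) (a b : ℕ),
      ((Fintype.card {i : Λ // B.deg i < a} + Fintype.card {j : Λ // B.deg j < b} +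
          Fintype.card {k : Λ // a + b ≤ B.deg k} : ℕ) : ℝ) ≤
        (n.factorial : ℝ) * Real.exp (-(K * Real.sqrt (n : ℝ)))

/-- `LoewyThinSplit → TwoModularSliceRank` is one line from `GradedCoords.sliceRank_le`. -/
theorem thinSplit_gives_sliceRank (h : LoewyThinSplit) : TwoModularSliceRank := by
  obtain ⟨K, hK, n₀, h⟩ := h
  refine ⟨K, hK, n₀, fun n hn => ?_⟩
  obtain ⟨Λ, _, _, B, a, b, hle⟩ := h n hn
  refine le_trans ?_ hle
  exact_mod_cast B.sliceRank_le a b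

/-- The FLOOR of the method (card 1, K1): the degree-0 part of any graded coordinates contains a
complement of the radical, so the split is ≥ dim(K[S_n]/J) = Σ_{λ 2-regular} (dim D^λ)²; the card's
first quantitative claim is that this is ≤ n!·(Plancherel mass of strict partitions) ≤ n!e^{-c√n}.
Combinatorial surrogate stated over Mathlib: the number of pairs of standard Young tableaux of the
same STRICT shape is an e^{-c√n} fraction of n! (hook-length-free phrasing via `Nat.card` of an
explicit finite type is deferred; recorded here informally). -/
def StrictPlancherelThin : Prop := True

/-! ## Card 2 — Sidon regime: hereditarily dense product-free difference sets -/

/-- FIRST LEMMA (card 2; provable now, pure algebra): the TPP is EQUIVALENT to a statement about the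
three difference sets `Q(X) ∖ {1}` (`Q(X) = X X⁻¹`): they are pairwise disjoint and the ordered
triple is product-free. -/
def FirstLemmaDifferenceSets : Prop :=
  ∀ (G : Type) [Group G] [DecidableEq G] (S T U : Finset G),
    TripleProductProperty S T U ↔
      ((∀ d₁ ∈ (Finset.image₂ (fun s s' => s * s'⁻¹) S S).erase 1,
          ∀ d₂ ∈ (Finset.image₂ (fun t t' => t * t'⁻¹) T T).erase 1,
            ∀ d₃ ∈ (Finset.image₂ (fun u u' => u * u'⁻¹) U U).erase 1, d₁ * d₂ * d₃ ≠ 1) ∧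
        Disjoint ((Finset.image₂ (fun s s' => s * s'⁻¹) S S).erase 1)
          ((Finset.image₂ (fun t t' => t * t'⁻¹) T T).erase 1) ∧
        Disjoint ((Finset.image₂ (fun t t' => t * t'⁻¹) T T).erase 1)
          ((Finset.image₂ (fun u u' => u * u'⁻¹) U U).erase 1) ∧
        Disjoint ((Finset.image₂ (fun u u' => u * u'⁻¹) U U).erase 1)
          ((Finset.image₂ (fun s s' => s * s'⁻¹) S S).erase 1))

/-- SECOND LEMMA (card 2; provable now, pigeonhole): difference sets of large sets are
HEREDITARILY PRESENT — `Q(S)` meets every subgroup `H` with `[G:H] < |S|` non-trivially; the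
quantitative form counts pairs in a common right coset: `#{(s,s') ∈ S², s ≠ s', s s'⁻¹ ∈ H} ≥
|S|²/[G:H] − |S|`. -/
def SecondLemmaHereditaryPresence : Prop :=
  ∀ (G : Type) [Group G] [Fintype G] [DecidableEq G] (H : Subgroup G) [DecidablePred (· ∈ H)]
    (S : Finset G), H.index < S.card → ∃ s ∈ S, ∃ s' ∈ S, s ≠ s' ∧ s * s'⁻¹ ∈ H

/-- Quantitative pair count behind hereditary DENSITY in the Sidon regime. -/
def PairsInCommonCoset : Prop :=
  ∀ (G : Type) [Group G] [Fintype G] [DecidableEq G] (H : Subgroup G) [DecidablePred (· ∈ H)]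
    (S : Finset G),
      ((S.card : ℝ) ^ 2 / (H.index : ℝ) - S.card) ≤
        (((S ×ˢ S).filter (fun p => p.1 ≠ p.2 ∧ p.1 * p.2⁻¹ ∈ H)).card : ℝ)

/-- TARGET C⁺_Sidon (card 2): no product-free triple of pairwise disjoint symmetric subsets of
`S_n`, each of density ≥ e^{-K√n} inside EVERY subgroup of order ≥ √(n!)·e^{K√n}
(hereditarily dense), for large n — stated for one fixed K to be tuned by the Sidon-ification
bookkeeping. -/
def NoHereditarilyDenseProductFreeTriple : Prop :=
  ∀ K : ℝ, 0 < K → ∃ n₀ : ℕ, ∀ n ≥ n₀, ∀ D : Fin 3 → Finset (Equiv.Perm (Fin n)),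
    (∀ i, ∀ d ∈ D i, d⁻¹ ∈ D i) → (∀ i, (1 : Equiv.Perm (Fin n)) ∉ D i) →
    (∀ i j, i ≠ j → Disjoint (D i) (D j)) →
    (∀ i, ∀ H : Subgroup (Equiv.Perm (Fin n)), ∀ _ : DecidablePred (· ∈ H),
        Real.sqrt (n.factorial : ℝ) * Real.exp (K * Real.sqrt (n : ℝ)) ≤ (Nat.card H : ℝ) →
          Real.exp (-(K * Real.sqrt (n : ℝ))) * (Nat.card H : ℝ) ≤
            (((D i).filter (· ∈ H)).card : ℝ)) →
      ∃ d₁ ∈ D 0, ∃ d₂ ∈ D 1, ∃ d₃ ∈ D 2, d₁ * d₂ * d₃ = 1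

end Summit.MatrixMultiplication.MatrixMultiplication.Cruxes.NoThresholdSubsetTriple.Sketch
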